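/-
Copyright: the b2b-balaban T⁴-continuum CRUX team, row NE7b OWNER lineage `t4-ne7b-p1` (gen 106). Project licence.
-/
import Summits.QuantumFields.BalabanUV.T4Continuum.Spine.NE7b.GaussianFibrewiseDecoupling

/-!
# THE NON-GAUSSIAN SMALL-FIELD REMAINDER AT THE LCS STEP, KERNEL SHARE: a local perturbation `e^{−V}` of the one-step density
# costs `e^{2v}` through its NEAR part only (`|V₁| ≤ v` on the small-field support); its FAR part `V₂(x₂)` costs NOTHING —
# residual (R2) reduced to a per-site norm of the near local terms (row NE7b, node U5c; kernel theorems of real analysis)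

Cell `pub-balaban`, sub-cell `t4`, spine estimate NE7b (`T4WeightBudget.RelWeightBound`; the cell's OWN estimate — NOT PRINTED in
[Bałaban 1983–89], NOT PROVED).  Crux-route work under `Spine/NE7b/` by the row's OWNER; NOTHING of Bałaban's is named or asserted;
no `T4Continuum/Support` leaf typed; no `def`; zero `sorry`.

WHY.  The owner's gen-105 files settled the GAUSSIAN share of the residual one-step lemma «LCS-j»
(`…NE7b.LocalConditionalStability.LocCondStability`): for one-step kernels `∝ F·e^{−xᵀSx}` the conditional moment of the sacrificed
form `e^{xᵀQx}` is bounded by displayed finite-dimensional data, and with COUPLED near ∕ far blocks everything reduces to the SHIFTED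
near-block moment, uniformly over far small fields (`…GaussianFibrewiseDecoupling.restrictedMoment_le_of_shifted_fibres`, residual
(R1′) → (R1″)).  The owner memo `A1C-LCS-RESIDUAL-g105.md` §2 then listed, as the next obligation of Bałaban's KIND with NO kernel
object, **(R2) the NON-GAUSSIAN small-field remainder**: the step's fluctuation density is `F·e^{−xᵀSx − V(x)}` with `V` the
non-quadratic part of the effective action — small term by term on the small-field domain but EXTENSIVE (a sum of local terms over the
whole lattice), so that the crude bound `|V| ≤ const` is a VOLUME factor.  THIS FILE proves the kernel share of (R2) by POSITIVITY
ALONE: split `V = V₁ + V₂` with `V₂ = V₂(x₂)` a function of the FAR variables only and `|V₁| ≤ v` on the support of the restriction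
`F₁(x₁)·F₂(x₂)`.  Then `e^{−V₂(x₂)} ≥ 0` is just one more factor of the far fibre weight — it multiplies numerator and denominator of
every fibre alike, exactly like `F₂` and `e^{−x₂ᵀS₂₂x₂}` in the gen-105 theorem (apply it with `F₂ ← F₂·e^{−V₂}`) — and `e^{−V₁}`
is sandwiched, `e^{−v} ≤ e^{−V₁} ≤ e^{v}`, once in the numerator and once in the denominator.  NET:
**perturbed restricted moment `≤ e^{2v} · C`** whenever the UNPERTURBED shifted near-block moments are `≤ C` on the far support
(the gen-105 hypothesis `hfib`, verbatim) — the far part `V₂`, whatever its size (it grows with the volume), enters NOWHERE except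
through integrability.  For `V = Σ_{X ∈ 𝒳} E_X` a sum of LOCAL terms (`E_X` depends on the coordinates in `X` only) the split is
forced: `V₁` = the terms TOUCHING the near block, `V₂` = the rest (a function of `x₂`, proved), and a PER-SITE norm
`Σ_{X ∋ i} w_X ≤ C₀` of the sup bounds `|E_X| ≤ w_X` on the small-field support gives `v ≤ #n₁ · C₀` — print's factor
«exp O(1)|Z_j ∩ Ω_j|» ([Balaban1989LargeFieldII] p. 383 l. 21–28) IN KIND for the non-Gaussian part, with the volume absent.
What (R2) still owes after this file is BY VALUE and of print's inductive kind: the sup bounds `w_X` of the effective action's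
local terms on the small-field domains with a per-site norm uniform in the running coupling ([Balaban1989LargeFieldI] §1, the
analyticity bounds on the spaces of effective actions) — the (A1c) instance's reading (R2′); and the cluster ∕ random-walk expansion of
[Balaban1989LargeFieldI] (0.3)–(0.5) is NOT needed for the relative BOUND (it is needed in print to re-localise the OUTPUT of the step,
which the LCS road does not ask).

WHAT IS PROVED ([folklore]; Bochner monotonicity, the gen-105 Fubini theorem, finite sums):
* §1 **`integral_le_of_sandwich`** (any measure: `A' ≤ e^{v}A`, `B ≤ e^{v}B'`, `∫A ≤ C∫B`, `0 ≤ C` ⟹ `∫A' ≤ e^{2v}C·∫B'`, with the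
  integrability of `A` and `B'` displayed), `integrable_of_sandwich` (the integrability conjunct transfers), `exp_neg_sandwich`,
  `mul_exp_neg_sandwich` (the pointwise sandwiches from `|V| ≤ v` on the support).
* §2 **`perturbedMoment_le_of_shifted_fibres`**: coupled blocks `[[S₁₁,S₁₂],[S₁₂ᵀ,S₂₂]]`, sacrificed form `Q₁ ⊕ 0`, restriction
  `F₁·F₂ ≥ 0`, perturbation `V₁(x) + V₂(x₂)` with `|V₁| ≤ v` where `F₁ ≠ 0 ∧ F₂ ≠ 0`; the UNPERTURBED fibre hypothesis `hfib` of
  `restrictedMoment_le_of_shifted_fibres` (constant `C ≥ 0`) ⟹ `∫ F e^{Q} e^{−S} e^{−V} ≤ e^{2v}·C·∫ F e^{−S} e^{−V}`;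
  `integrable_perturbedNumerator` (the LCS integrability conjunct for the perturbed numerator from the hybrid one);
  `perturbedMoment_div_le` (ratio form).
* §3 LOCAL TERMS: `far_term_eq` (a local term not touching the near block is a function of `x₂`), `sum_localTerms_split`
  (`Σ_X E_X = V₁ + V₂(x₂)`), `abs_nearSum_le`, **`nearNorm_le_card_mul`** (per-site norm `C₀` ⟹ `Σ_{X touching} w_X ≤ #n₁·C₀`),
  and the assembled **`perturbedMoment_le_of_localTerms`** (`… ≤ e^{2·#n₁·C₀}·C·…`).

NOT HERE (honest): the sup bounds `w_X` and their per-site norm for Bałaban's effective actions ((R2′), (A1c) reading); the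
induced-mean energy bounds (R1″) behind `hfib` (suppliers: `…GaussianShiftedFibre(Moment)`, `…GaussianInducedMeanDecay`,
`…GaussianTranslatedMass`); positivity of the FULL action on backgrounds large on the pinned region ([Balaban1989LargeFieldI] (0.4));
anything of Bałaban's.  NE7b NOT PRINTED ∕ NOT PROVED; spine PROVED 0∕9; rung (B)+1 on a FINITE torus — NOT infinite volume, NOT the
mass gap, NOT Clay.
HONEST DEPENDENCY: continuum YM on T⁴ ⇐ BetaPertH ∧ nine spine estimates (0/9 proved); BetaPertH ⇐ (D1) ∧ (D4) ∧ CAP+tail.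
-/

set_option autoImplicit false

open Matrix Finset MeasureTheory Real
open Summit.QuantumFields.BalabanUV.T4Continuum.NE7b.GaussianBlockDecoupling
open Summit.QuantumFields.BalabanUV.T4Continuum.NE7b.GaussianFibrewiseDecoupling

namespace Summit.QuantumFields.BalabanUV.T4Continuum.NE7b.LocalPerturbationSandwich

/-! ## §1 The sandwich: a perturbation factor in `[e^{−v}, e^{v}]` on the support costs `e^{2v}` in a relative bound -/

section Sandwich

variable {X : Type*} [MeasurableSpace X] (μ : Measure X)

/-- `|V| ≤ v` sandwiches `e^{−V}` between `e^{−v}` and `e^{v}`. [folklore] -/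
theorem exp_neg_sandwich {V v : ℝ} (h : |V| ≤ v) : exp (-v) ≤ exp (-V) ∧ exp (-V) ≤ exp v := by
  rw [abs_le] at h
  exact ⟨exp_le_exp.2 (by linarith), exp_le_exp.2 (by linarith)⟩

/-- **THE POINTWISE SANDWICH ON THE SUPPORT**: for `a ≥ 0` and `|V| ≤ v` wherever `a ≠ 0`,
`a·e^{−V} ≤ e^{v}·a` and `a ≤ e^{v}·(a·e^{−V})`. [folklore] -/
theorem mul_exp_neg_sandwich {a V v : ℝ} (ha : 0 ≤ a) (hV : a ≠ 0 → |V| ≤ v) :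
    a * exp (-V) ≤ exp v * a ∧ a ≤ exp v * (a * exp (-V)) := by
  by_cases h0 : a = 0
  · simp [h0]
  · obtain ⟨h1, h2⟩ := exp_neg_sandwich (hV h0)
    refine ⟨by rw [mul_comm (exp v)]; exact mul_le_mul_of_nonneg_left h2 ha, ?_⟩
    calc a = (exp v * exp (-v)) * a := by rw [← exp_add, add_neg_cancel, exp_zero, one_mul]
      _ ≤ (exp v * exp (-V)) * a := mul_le_mul_of_nonneg_right (mul_le_mul_of_nonneg_left h1 (exp_pos _).le) ha
      _ = exp v * (a * exp (-V)) := by ring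

/-- **THE SANDWICH INTEGRATES** (any measure): if `0 ≤ A' ≤ e^{v}·A` and `0 ≤ B ≤ e^{v}·B'` pointwise, `A` and `B'` are integrable,
`0 ≤ C` and `∫A ≤ C·∫B`, then `∫A' ≤ e^{2v}·C·∫B'`.  (The two non-displayed integrabilities are not needed: a non-integrable
non-negative `A'` or `B` has Bochner integral `0`.) [folklore] -/
theorem integral_le_of_sandwich {A B A' B' : X → ℝ} {C v : ℝ} (hC : 0 ≤ C) (hA' : ∀ x, 0 ≤ A' x) (hB : ∀ x, 0 ≤ B x)
    (hAA : ∀ x, A' x ≤ exp v * A x) (hBB : ∀ x, B x ≤ exp v * B' x) (hAi : Integrable A μ) (hB'i : Integrable B' μ)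
    (hmom : ∫ x, A x ∂μ ≤ C * ∫ x, B x ∂μ) :
    ∫ x, A' x ∂μ ≤ (exp (2 * v) * C) * ∫ x, B' x ∂μ := by
  have h1 : ∫ x, A' x ∂μ ≤ exp v * ∫ x, A x ∂μ := by
    rw [← integral_const_mul]
    exact integral_mono_of_nonneg (Filter.Eventually.of_forall hA') (hAi.const_mul _) (Filter.Eventually.of_forall hAA)
  have h2 : ∫ x, B x ∂μ ≤ exp v * ∫ x, B' x ∂μ := by
    rw [← integral_const_mul]
    exact integral_mono_of_nonneg (Filter.Eventually.of_forall hB) (hB'i.const_mul _) (Filter.Eventually.of_forall hBB)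
  calc ∫ x, A' x ∂μ ≤ exp v * ∫ x, A x ∂μ := h1
    _ ≤ exp v * (C * ∫ x, B x ∂μ) := mul_le_mul_of_nonneg_left hmom (exp_pos _).le
    _ ≤ exp v * (C * (exp v * ∫ x, B' x ∂μ)) :=
        mul_le_mul_of_nonneg_left (mul_le_mul_of_nonneg_left h2 hC) (exp_pos _).le
    _ = (exp (2 * v) * C) * ∫ x, B' x ∂μ := by rw [two_mul, exp_add]; ring

/-- **THE INTEGRABILITY CONJUNCT TRANSFERS**: `0 ≤ A' ≤ e^{v}·A` with `A` integrable and `A'` a.e.-strongly measurable makes `A'`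
integrable. [folklore] -/
theorem integrable_of_sandwich {A A' : X → ℝ} {v : ℝ} (hA' : ∀ x, 0 ≤ A' x) (hAA : ∀ x, A' x ≤ exp v * A x)
    (hAi : Integrable A μ) (hmeas : AEStronglyMeasurable A' μ) : Integrable A' μ := by
  refine (hAi.const_mul (exp v)).mono' hmeas (Filter.Eventually.of_forall fun x => ?_)
  rw [Real.norm_eq_abs, abs_of_nonneg (hA' x)]
  exact hAA x

end Sandwich

/-! ## §2 The perturbed restricted moment with coupled blocks: the far part of the perturbation never enters -/

section Perturbed

variable {n₁ n₂ : Type} [Fintype n₁] [Fintype n₂]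

/-- `e^{−(a + b)} = e^{−a}·e^{−b}`. [folklore] -/
theorem exp_neg_add (a b : ℝ) : exp (-(a + b)) = exp (-a) * exp (-b) := by
  rw [neg_add, exp_add]

/-- **THE PERTURBED RESTRICTED MOMENT IS CONTROLLED BY THE UNPERTURBED SHIFTED FIBRES AND THE NEAR SUP BOUND ALONE.**
Blocks `x₁` (near) and `x₂` (far) coupled through `S₁₂`; sacrificed form `Q₁ ⊕ 0`; restriction `F₁(x₁)·F₂(x₂)` with `F₁, F₂ ≥ 0`;
perturbation `V₁(x) + V₂(x₂)` of the action with `|V₁ x| ≤ v` wherever `F₁(x₁) ≠ 0` and `F₂(x₂) ≠ 0` (the small-field support) and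
`V₂` ARBITRARY.  If on every far configuration with `F₂ x₂ ≠ 0` the UNPERTURBED shifted near-block restricted moment is dominated with
the constant `C ≥ 0` (the hypothesis `hfib` of `…GaussianFibrewiseDecoupling.restrictedMoment_le_of_shifted_fibres`, verbatim), then
`∫ F₁F₂·e^{xᵀ(Q₁⊕0)x}·e^{−xᵀSx}·e^{−(V₁+V₂)} ≤ e^{2v}·C·∫ F₁F₂·e^{−xᵀSx}·e^{−(V₁+V₂)}`.  Displayed integrabilities: the two HYBRID
integrands (far part perturbed, near part not — i.e. the gen-105 integrands with `F₂ ← F₂·e^{−V₂}`) and the perturbed denominator.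
[folklore] -/
theorem perturbedMoment_le_of_shifted_fibres (S₁₁ Q₁ : Matrix n₁ n₁ ℝ) (S₁₂ : Matrix n₁ n₂ ℝ) (S₂₂ : Matrix n₂ n₂ ℝ)
    (F₁ : (n₁ → ℝ) → ℝ) (F₂ : (n₂ → ℝ) → ℝ) (V₁ : (n₁ ⊕ n₂ → ℝ) → ℝ) (V₂ : (n₂ → ℝ) → ℝ) {C v : ℝ}
    (hF₁ : ∀ x₁, 0 ≤ F₁ x₁) (hF₂ : ∀ x₂, 0 ≤ F₂ x₂) (hC : 0 ≤ C)
    (hV₁ : ∀ x : n₁ ⊕ n₂ → ℝ, F₁ (fun i => x (Sum.inl i)) ≠ 0 → F₂ (fun i => x (Sum.inr i)) ≠ 0 → |V₁ x| ≤ v)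
    (hA : Integrable fun x : n₁ ⊕ n₂ → ℝ =>
      (F₁ (fun i => x (Sum.inl i)) * (F₂ (fun i => x (Sum.inr i)) * exp (-V₂ (fun i => x (Sum.inr i))))) *
        (exp (x ⬝ᵥ (Matrix.fromBlocks Q₁ 0 0 (0 : Matrix n₂ n₂ ℝ) *ᵥ x)) *
          exp (-(x ⬝ᵥ (Matrix.fromBlocks S₁₁ S₁₂ S₁₂ᵀ S₂₂ *ᵥ x)))))
    (hB : Integrable fun x : n₁ ⊕ n₂ → ℝ =>
      (F₁ (fun i => x (Sum.inl i)) * (F₂ (fun i => x (Sum.inr i)) * exp (-V₂ (fun i => x (Sum.inr i))))) *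
        exp (-(x ⬝ᵥ (Matrix.fromBlocks S₁₁ S₁₂ S₁₂ᵀ S₂₂ *ᵥ x))))
    (hB' : Integrable fun x : n₁ ⊕ n₂ → ℝ => (F₁ (fun i => x (Sum.inl i)) * F₂ (fun i => x (Sum.inr i))) *
      (exp (-(x ⬝ᵥ (Matrix.fromBlocks S₁₁ S₁₂ S₁₂ᵀ S₂₂ *ᵥ x))) * exp (-(V₁ x + V₂ (fun i => x (Sum.inr i))))))
    (hfib : ∀ x₂, F₂ x₂ ≠ 0 →
      ∫ x₁, F₁ x₁ * (exp (x₁ ⬝ᵥ (Q₁ *ᵥ x₁)) * exp (-(x₁ ⬝ᵥ (S₁₁ *ᵥ x₁) + 2 * (x₁ ⬝ᵥ (S₁₂ *ᵥ x₂))))) ≤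
        C * ∫ x₁, F₁ x₁ * exp (-(x₁ ⬝ᵥ (S₁₁ *ᵥ x₁) + 2 * (x₁ ⬝ᵥ (S₁₂ *ᵥ x₂))))) :
    ∫ x : n₁ ⊕ n₂ → ℝ, (F₁ (fun i => x (Sum.inl i)) * F₂ (fun i => x (Sum.inr i))) *
        ((exp (x ⬝ᵥ (Matrix.fromBlocks Q₁ 0 0 (0 : Matrix n₂ n₂ ℝ) *ᵥ x)) *
          exp (-(x ⬝ᵥ (Matrix.fromBlocks S₁₁ S₁₂ S₁₂ᵀ S₂₂ *ᵥ x)))) * exp (-(V₁ x + V₂ (fun i => x (Sum.inr i))))) ≤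
      (exp (2 * v) * C) * ∫ x : n₁ ⊕ n₂ → ℝ, (F₁ (fun i => x (Sum.inl i)) * F₂ (fun i => x (Sum.inr i))) *
        (exp (-(x ⬝ᵥ (Matrix.fromBlocks S₁₁ S₁₂ S₁₂ᵀ S₂₂ *ᵥ x))) * exp (-(V₁ x + V₂ (fun i => x (Sum.inr i))))) := by
  -- the gen-105 theorem with the far weight `F₂·e^{−V₂}`
  have hF₂' : ∀ x₂, 0 ≤ F₂ x₂ * exp (-V₂ x₂) := fun x₂ => mul_nonneg (hF₂ x₂) (exp_pos _).le
  have hmom := restrictedMoment_le_of_shifted_fibres S₁₁ Q₁ S₁₂ S₂₂ F₁ (fun x₂ => F₂ x₂ * exp (-V₂ x₂)) hF₂' hA hB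
    fun x₂ hx₂ => hfib x₂ (left_ne_zero_of_mul hx₂)
  refine integral_le_of_sandwich volume hC (fun x => ?_) (fun x => ?_) (fun x => ?_) (fun x => ?_) hA hB' hmom
  · exact mul_nonneg (mul_nonneg (hF₁ _) (hF₂ _)) (mul_nonneg (mul_nonneg (exp_pos _).le (exp_pos _).le) (exp_pos _).le)
  · exact mul_nonneg (mul_nonneg (hF₁ _) (hF₂' _)) (exp_pos _).le
  · -- numerator: `A' = A·e^{−V₁} ≤ e^{v}·A`
    have ha : 0 ≤ (F₁ (fun i => x (Sum.inl i)) * (F₂ (fun i => x (Sum.inr i)) * exp (-V₂ (fun i => x (Sum.inr i))))) *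
        (exp (x ⬝ᵥ (Matrix.fromBlocks Q₁ 0 0 (0 : Matrix n₂ n₂ ℝ) *ᵥ x)) *
          exp (-(x ⬝ᵥ (Matrix.fromBlocks S₁₁ S₁₂ S₁₂ᵀ S₂₂ *ᵥ x)))) :=
      mul_nonneg (mul_nonneg (hF₁ _) (hF₂' _)) (mul_nonneg (exp_pos _).le (exp_pos _).le)
    have hs := (mul_exp_neg_sandwich (V := V₁ x) ha fun hne => hV₁ x
      (fun h0 => hne (by rw [h0, zero_mul, zero_mul])) (fun h0 => hne (by rw [h0, zero_mul, mul_zero, zero_mul]))).1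
    calc (F₁ (fun i => x (Sum.inl i)) * F₂ (fun i => x (Sum.inr i))) *
          ((exp (x ⬝ᵥ (Matrix.fromBlocks Q₁ 0 0 (0 : Matrix n₂ n₂ ℝ) *ᵥ x)) *
            exp (-(x ⬝ᵥ (Matrix.fromBlocks S₁₁ S₁₂ S₁₂ᵀ S₂₂ *ᵥ x)))) * exp (-(V₁ x + V₂ (fun i => x (Sum.inr i)))))
        = (F₁ (fun i => x (Sum.inl i)) * (F₂ (fun i => x (Sum.inr i)) * exp (-V₂ (fun i => x (Sum.inr i))))) *
            (exp (x ⬝ᵥ (Matrix.fromBlocks Q₁ 0 0 (0 : Matrix n₂ n₂ ℝ) *ᵥ x)) *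
              exp (-(x ⬝ᵥ (Matrix.fromBlocks S₁₁ S₁₂ S₁₂ᵀ S₂₂ *ᵥ x)))) * exp (-V₁ x) := by
          rw [exp_neg_add]; ring
      _ ≤ _ := hs
  · -- denominator: `B ≤ e^{v}·B' = e^{v}·B·e^{−V₁}`
    have hb : 0 ≤ (F₁ (fun i => x (Sum.inl i)) * (F₂ (fun i => x (Sum.inr i)) * exp (-V₂ (fun i => x (Sum.inr i))))) *
        exp (-(x ⬝ᵥ (Matrix.fromBlocks S₁₁ S₁₂ S₁₂ᵀ S₂₂ *ᵥ x))) := mul_nonneg (mul_nonneg (hF₁ _) (hF₂' _)) (exp_pos _).le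
    have hs := (mul_exp_neg_sandwich (V := V₁ x) hb fun hne => hV₁ x
      (fun h0 => hne (by rw [h0, zero_mul, zero_mul])) (fun h0 => hne (by rw [h0, zero_mul, mul_zero, zero_mul]))).2
    calc (F₁ (fun i => x (Sum.inl i)) * (F₂ (fun i => x (Sum.inr i)) * exp (-V₂ (fun i => x (Sum.inr i))))) *
          exp (-(x ⬝ᵥ (Matrix.fromBlocks S₁₁ S₁₂ S₁₂ᵀ S₂₂ *ᵥ x)))
        ≤ exp v * ((F₁ (fun i => x (Sum.inl i)) * (F₂ (fun i => x (Sum.inr i)) * exp (-V₂ (fun i => x (Sum.inr i))))) *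
            exp (-(x ⬝ᵥ (Matrix.fromBlocks S₁₁ S₁₂ S₁₂ᵀ S₂₂ *ᵥ x))) * exp (-V₁ x)) := hs
      _ = exp v * ((F₁ (fun i => x (Sum.inl i)) * F₂ (fun i => x (Sum.inr i))) *
            (exp (-(x ⬝ᵥ (Matrix.fromBlocks S₁₁ S₁₂ S₁₂ᵀ S₂₂ *ᵥ x))) * exp (-(V₁ x + V₂ (fun i => x (Sum.inr i)))))) := by
          rw [exp_neg_add]; ring

/-- **THE LCS INTEGRABILITY CONJUNCT FOR THE PERTURBED NUMERATOR** from the hybrid one: `|V₁| ≤ v` on the support and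
a.e.-strong measurability of the perturbed numerator. [folklore] -/
theorem integrable_perturbedNumerator (S₁₁ Q₁ : Matrix n₁ n₁ ℝ) (S₁₂ : Matrix n₁ n₂ ℝ) (S₂₂ : Matrix n₂ n₂ ℝ)
    (F₁ : (n₁ → ℝ) → ℝ) (F₂ : (n₂ → ℝ) → ℝ) (V₁ : (n₁ ⊕ n₂ → ℝ) → ℝ) (V₂ : (n₂ → ℝ) → ℝ) {v : ℝ}
    (hF₁ : ∀ x₁, 0 ≤ F₁ x₁) (hF₂ : ∀ x₂, 0 ≤ F₂ x₂)
    (hV₁ : ∀ x : n₁ ⊕ n₂ → ℝ, F₁ (fun i => x (Sum.inl i)) ≠ 0 → F₂ (fun i => x (Sum.inr i)) ≠ 0 → |V₁ x| ≤ v)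
    (hA : Integrable fun x : n₁ ⊕ n₂ → ℝ =>
      (F₁ (fun i => x (Sum.inl i)) * (F₂ (fun i => x (Sum.inr i)) * exp (-V₂ (fun i => x (Sum.inr i))))) *
        (exp (x ⬝ᵥ (Matrix.fromBlocks Q₁ 0 0 (0 : Matrix n₂ n₂ ℝ) *ᵥ x)) *
          exp (-(x ⬝ᵥ (Matrix.fromBlocks S₁₁ S₁₂ S₁₂ᵀ S₂₂ *ᵥ x)))))
    (hmeas : AEStronglyMeasurable (fun x : n₁ ⊕ n₂ → ℝ => (F₁ (fun i => x (Sum.inl i)) * F₂ (fun i => x (Sum.inr i))) *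
        ((exp (x ⬝ᵥ (Matrix.fromBlocks Q₁ 0 0 (0 : Matrix n₂ n₂ ℝ) *ᵥ x)) *
          exp (-(x ⬝ᵥ (Matrix.fromBlocks S₁₁ S₁₂ S₁₂ᵀ S₂₂ *ᵥ x)))) * exp (-(V₁ x + V₂ (fun i => x (Sum.inr i)))))) volume) :
    Integrable fun x : n₁ ⊕ n₂ → ℝ => (F₁ (fun i => x (Sum.inl i)) * F₂ (fun i => x (Sum.inr i))) *
        ((exp (x ⬝ᵥ (Matrix.fromBlocks Q₁ 0 0 (0 : Matrix n₂ n₂ ℝ) *ᵥ x)) *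
          exp (-(x ⬝ᵥ (Matrix.fromBlocks S₁₁ S₁₂ S₁₂ᵀ S₂₂ *ᵥ x)))) * exp (-(V₁ x + V₂ (fun i => x (Sum.inr i))))) := by
  have hF₂' : ∀ x₂, 0 ≤ F₂ x₂ * exp (-V₂ x₂) := fun x₂ => mul_nonneg (hF₂ x₂) (exp_pos _).le
  refine integrable_of_sandwich volume (v := v) (fun x => ?_) (fun x => ?_) hA hmeas
  · exact mul_nonneg (mul_nonneg (hF₁ _) (hF₂ _)) (mul_nonneg (mul_nonneg (exp_pos _).le (exp_pos _).le) (exp_pos _).le)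
  · have ha : 0 ≤ (F₁ (fun i => x (Sum.inl i)) * (F₂ (fun i => x (Sum.inr i)) * exp (-V₂ (fun i => x (Sum.inr i))))) *
        (exp (x ⬝ᵥ (Matrix.fromBlocks Q₁ 0 0 (0 : Matrix n₂ n₂ ℝ) *ᵥ x)) *
          exp (-(x ⬝ᵥ (Matrix.fromBlocks S₁₁ S₁₂ S₁₂ᵀ S₂₂ *ᵥ x)))) :=
      mul_nonneg (mul_nonneg (hF₁ _) (hF₂' _)) (mul_nonneg (exp_pos _).le (exp_pos _).le)
    have hs := (mul_exp_neg_sandwich (V := V₁ x) ha fun hne => hV₁ x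
      (fun h0 => hne (by rw [h0, zero_mul, zero_mul])) (fun h0 => hne (by rw [h0, zero_mul, mul_zero, zero_mul]))).1
    calc (F₁ (fun i => x (Sum.inl i)) * F₂ (fun i => x (Sum.inr i))) *
          ((exp (x ⬝ᵥ (Matrix.fromBlocks Q₁ 0 0 (0 : Matrix n₂ n₂ ℝ) *ᵥ x)) *
            exp (-(x ⬝ᵥ (Matrix.fromBlocks S₁₁ S₁₂ S₁₂ᵀ S₂₂ *ᵥ x)))) * exp (-(V₁ x + V₂ (fun i => x (Sum.inr i)))))
        = (F₁ (fun i => x (Sum.inl i)) * (F₂ (fun i => x (Sum.inr i)) * exp (-V₂ (fun i => x (Sum.inr i))))) *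
            (exp (x ⬝ᵥ (Matrix.fromBlocks Q₁ 0 0 (0 : Matrix n₂ n₂ ℝ) *ᵥ x)) *
              exp (-(x ⬝ᵥ (Matrix.fromBlocks S₁₁ S₁₂ S₁₂ᵀ S₂₂ *ᵥ x)))) * exp (-V₁ x) := by
          rw [exp_neg_add]; ring
      _ ≤ _ := hs

/-- **RATIO FORM** (arithmetic of the carrier): `N ≤ K·D` with `K, D ≥ 0` gives `N ∕ D ≤ K` (Lean's `x ∕ 0 = 0`), so the
perturbed conditional moment — numerator ∕ denominator of `perturbedMoment_le_of_shifted_fibres` — is at most `e^{2v}·C`, the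
shape `…CarrierOnSupport.locCondStability_of_carrier_le_on_support` consumes. [folklore] -/
theorem div_le_of_le_mul {N D K : ℝ} (hK : 0 ≤ K) (hD : 0 ≤ D) (h : N ≤ K * D) : N / D ≤ K := by
  rcases hD.lt_or_eq with hD | hD
  · rwa [div_le_iff₀ hD]
  · rw [← hD, div_zero]; exact hK

end Perturbed

/-! ## §3 Local terms: the split is forced, and a per-site norm of the near terms gives `v ≤ #n₁ · C₀` -/

section LocalTerms

variable {n₁ n₂ : Type} [Fintype n₁] [Fintype n₂] [DecidableEq n₁] [DecidableEq n₂]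

omit [Fintype n₁] [Fintype n₂] [DecidableEq n₁] [DecidableEq n₂] in
/-- **A LOCAL TERM NOT TOUCHING THE NEAR BLOCK IS A FUNCTION OF THE FAR VARIABLES**: if `E` depends on the coordinates in `X`
only and `X` contains no near coordinate, then `E x = E (0 ⊕ x₂)`. [folklore] -/
theorem far_term_eq (X : Finset (n₁ ⊕ n₂)) (E : ((n₁ ⊕ n₂) → ℝ) → ℝ)
    (hloc : ∀ x y : (n₁ ⊕ n₂) → ℝ, (∀ i ∈ X, x i = y i) → E x = E y) (hfar : ¬ ∃ i : n₁, Sum.inl i ∈ X)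
    (x : (n₁ ⊕ n₂) → ℝ) : E x = E (Sum.elim 0 fun j => x (Sum.inr j)) := by
  refine hloc x _ fun i hi => ?_
  cases i with
  | inl a => exact absurd ⟨a, hi⟩ hfar
  | inr b => rfl

omit [Fintype n₂] in
/-- **THE SPLIT IS FORCED**: a sum of local terms is (the terms touching the near block) + (a function of the far variables).
[folklore] -/
theorem sum_localTerms_split (𝒳 : Finset (Finset (n₁ ⊕ n₂))) (E : Finset (n₁ ⊕ n₂) → ((n₁ ⊕ n₂) → ℝ) → ℝ)
    (hloc : ∀ X ∈ 𝒳, ∀ x y : (n₁ ⊕ n₂) → ℝ, (∀ i ∈ X, x i = y i) → E X x = E X y) (x : (n₁ ⊕ n₂) → ℝ) :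
    ∑ X ∈ 𝒳, E X x =
      ∑ X ∈ 𝒳.filter (fun X => ∃ i : n₁, Sum.inl i ∈ X), E X x +
        ∑ X ∈ 𝒳.filter (fun X => ¬ ∃ i : n₁, Sum.inl i ∈ X), E X (Sum.elim 0 fun j => x (Sum.inr j)) := by
  rw [← Finset.sum_filter_add_sum_filter_not 𝒳 (fun X => ∃ i : n₁, Sum.inl i ∈ X)]
  congr 1
  exact Finset.sum_congr rfl fun X hX =>
    far_term_eq X (E X) (hloc X (Finset.mem_filter.1 hX).1) (Finset.mem_filter.1 hX).2 x

omit [Fintype n₂] in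
/-- The near part is bounded by the sum of the sup bounds of the touching terms. [folklore] -/
theorem abs_nearSum_le (𝒳 : Finset (Finset (n₁ ⊕ n₂))) (E : Finset (n₁ ⊕ n₂) → ((n₁ ⊕ n₂) → ℝ) → ℝ)
    (w : Finset (n₁ ⊕ n₂) → ℝ) (x : (n₁ ⊕ n₂) → ℝ) (hw : ∀ X ∈ 𝒳, (∃ i : n₁, Sum.inl i ∈ X) → |E X x| ≤ w X) :
    |∑ X ∈ 𝒳.filter (fun X => ∃ i : n₁, Sum.inl i ∈ X), E X x| ≤
      ∑ X ∈ 𝒳.filter (fun X => ∃ i : n₁, Sum.inl i ∈ X), w X :=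
  (Finset.abs_sum_le_sum_abs _ _).trans
    (Finset.sum_le_sum fun X hX => hw X (Finset.mem_filter.1 hX).1 (Finset.mem_filter.1 hX).2)

omit [Fintype n₂] in
/-- **A PER-SITE NORM GIVES THE VOLUME OF THE NEAR BLOCK, NOT OF THE LATTICE**: if for every near coordinate `i` the sup bounds
of the terms containing it sum to at most `C₀` (`w ≥ 0`), then the sup bounds of ALL terms touching the near block sum to at most
`#n₁ · C₀` (union bound over the near coordinates). [folklore] -/
theorem nearNorm_le_card_mul (𝒳 : Finset (Finset (n₁ ⊕ n₂))) (w : Finset (n₁ ⊕ n₂) → ℝ) (hw0 : ∀ X ∈ 𝒳, 0 ≤ w X)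
    {C₀ : ℝ} (hnorm : ∀ i : n₁, ∑ X ∈ 𝒳.filter (fun X => Sum.inl i ∈ X), w X ≤ C₀) :
    ∑ X ∈ 𝒳.filter (fun X => ∃ i : n₁, Sum.inl i ∈ X), w X ≤ Fintype.card n₁ * C₀ := by
  have h1 : ∀ X ∈ 𝒳.filter (fun X => ∃ i : n₁, Sum.inl i ∈ X),
      w X ≤ ∑ i : n₁, if Sum.inl i ∈ X then w X else 0 := by
    intro X hX
    obtain ⟨h𝒳, i, hi⟩ := Finset.mem_filter.1 hX
    calc w X = if Sum.inl i ∈ X then w X else 0 := by rw [if_pos hi]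
      _ ≤ ∑ i : n₁, if Sum.inl i ∈ X then w X else 0 :=
          Finset.single_le_sum (f := fun i : n₁ => if Sum.inl i ∈ X then w X else 0)
            (fun j _ => by
              split_ifs
              · exact hw0 X h𝒳
              · exact le_rfl) (Finset.mem_univ i)
  calc ∑ X ∈ 𝒳.filter (fun X => ∃ i : n₁, Sum.inl i ∈ X), w X
      ≤ ∑ X ∈ 𝒳.filter (fun X => ∃ i : n₁, Sum.inl i ∈ X), ∑ i : n₁, if Sum.inl i ∈ X then w X else 0 :=
        Finset.sum_le_sum h1
    _ = ∑ i : n₁, ∑ X ∈ 𝒳.filter (fun X => ∃ i : n₁, Sum.inl i ∈ X), if Sum.inl i ∈ X then w X else 0 :=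
        Finset.sum_comm
    _ ≤ ∑ i : n₁, ∑ X ∈ 𝒳.filter (fun X => Sum.inl i ∈ X), w X := by
        refine Finset.sum_le_sum fun i _ => ?_
        rw [← Finset.sum_filter]
        refine Finset.sum_le_sum_of_subset_of_nonneg (fun X hX => ?_) fun X hX _ => hw0 X (Finset.mem_filter.1 hX).1
        simp only [Finset.mem_filter] at hX ⊢
        exact ⟨hX.1.1, hX.2⟩
    _ ≤ ∑ _i : n₁, C₀ := Finset.sum_le_sum fun i _ => hnorm i
    _ = Fintype.card n₁ * C₀ := by rw [Finset.sum_const, Finset.card_univ, nsmul_eq_mul]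

/-- **(R2) FROM A PER-SITE NORM OF THE NEAR LOCAL TERMS**: perturbation `V = Σ_{X ∈ 𝒳} E_X` by LOCAL terms (`E_X` depends on the
coordinates in `X` only) with sup bounds `|E_X| ≤ w_X` on the small-field support for the terms touching the near block and the
per-site norm `Σ_{X ∋ i} w_X ≤ C₀` at every near coordinate; the UNPERTURBED fibre hypothesis `hfib` (constant `C ≥ 0`) ⟹
`∫ F₁F₂·e^{Q}·e^{−S}·e^{−V} ≤ e^{2·#n₁·C₀}·C·∫ F₁F₂·e^{−S}·e^{−V}` — the far terms, however many, enter only through the displayed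
integrabilities (hybrid integrands: far terms kept, near terms dropped). [folklore] -/
theorem perturbedMoment_le_of_localTerms (S₁₁ Q₁ : Matrix n₁ n₁ ℝ) (S₁₂ : Matrix n₁ n₂ ℝ) (S₂₂ : Matrix n₂ n₂ ℝ)
    (F₁ : (n₁ → ℝ) → ℝ) (F₂ : (n₂ → ℝ) → ℝ) (𝒳 : Finset (Finset (n₁ ⊕ n₂)))
    (E : Finset (n₁ ⊕ n₂) → ((n₁ ⊕ n₂) → ℝ) → ℝ) (w : Finset (n₁ ⊕ n₂) → ℝ) {C C₀ : ℝ}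
    (hF₁ : ∀ x₁, 0 ≤ F₁ x₁) (hF₂ : ∀ x₂, 0 ≤ F₂ x₂) (hC : 0 ≤ C)
    (hloc : ∀ X ∈ 𝒳, ∀ x y : (n₁ ⊕ n₂) → ℝ, (∀ i ∈ X, x i = y i) → E X x = E X y)
    (hw : ∀ X ∈ 𝒳, (∃ i : n₁, Sum.inl i ∈ X) → ∀ x : (n₁ ⊕ n₂) → ℝ,
      F₁ (fun i => x (Sum.inl i)) ≠ 0 → F₂ (fun i => x (Sum.inr i)) ≠ 0 → |E X x| ≤ w X)
    (hw0 : ∀ X ∈ 𝒳, 0 ≤ w X) (hnorm : ∀ i : n₁, ∑ X ∈ 𝒳.filter (fun X => Sum.inl i ∈ X), w X ≤ C₀)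
    (hA : Integrable fun x : n₁ ⊕ n₂ → ℝ =>
      (F₁ (fun i => x (Sum.inl i)) * (F₂ (fun i => x (Sum.inr i)) *
        exp (-(∑ X ∈ 𝒳.filter (fun X => ¬ ∃ i : n₁, Sum.inl i ∈ X), E X (Sum.elim 0 fun j => x (Sum.inr j)))))) *
        (exp (x ⬝ᵥ (Matrix.fromBlocks Q₁ 0 0 (0 : Matrix n₂ n₂ ℝ) *ᵥ x)) *
          exp (-(x ⬝ᵥ (Matrix.fromBlocks S₁₁ S₁₂ S₁₂ᵀ S₂₂ *ᵥ x)))))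
    (hB : Integrable fun x : n₁ ⊕ n₂ → ℝ =>
      (F₁ (fun i => x (Sum.inl i)) * (F₂ (fun i => x (Sum.inr i)) *
        exp (-(∑ X ∈ 𝒳.filter (fun X => ¬ ∃ i : n₁, Sum.inl i ∈ X), E X (Sum.elim 0 fun j => x (Sum.inr j)))))) *
        exp (-(x ⬝ᵥ (Matrix.fromBlocks S₁₁ S₁₂ S₁₂ᵀ S₂₂ *ᵥ x))))
    (hB' : Integrable fun x : n₁ ⊕ n₂ → ℝ => (F₁ (fun i => x (Sum.inl i)) * F₂ (fun i => x (Sum.inr i))) *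
      (exp (-(x ⬝ᵥ (Matrix.fromBlocks S₁₁ S₁₂ S₁₂ᵀ S₂₂ *ᵥ x))) * exp (-(∑ X ∈ 𝒳, E X x))))
    (hfib : ∀ x₂, F₂ x₂ ≠ 0 →
      ∫ x₁, F₁ x₁ * (exp (x₁ ⬝ᵥ (Q₁ *ᵥ x₁)) * exp (-(x₁ ⬝ᵥ (S₁₁ *ᵥ x₁) + 2 * (x₁ ⬝ᵥ (S₁₂ *ᵥ x₂))))) ≤
        C * ∫ x₁, F₁ x₁ * exp (-(x₁ ⬝ᵥ (S₁₁ *ᵥ x₁) + 2 * (x₁ ⬝ᵥ (S₁₂ *ᵥ x₂))))) :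
    ∫ x : n₁ ⊕ n₂ → ℝ, (F₁ (fun i => x (Sum.inl i)) * F₂ (fun i => x (Sum.inr i))) *
        ((exp (x ⬝ᵥ (Matrix.fromBlocks Q₁ 0 0 (0 : Matrix n₂ n₂ ℝ) *ᵥ x)) *
          exp (-(x ⬝ᵥ (Matrix.fromBlocks S₁₁ S₁₂ S₁₂ᵀ S₂₂ *ᵥ x)))) * exp (-(∑ X ∈ 𝒳, E X x))) ≤
      (exp (2 * (Fintype.card n₁ * C₀)) * C) * ∫ x : n₁ ⊕ n₂ → ℝ, (F₁ (fun i => x (Sum.inl i)) * F₂ (fun i => x (Sum.inr i))) *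
        (exp (-(x ⬝ᵥ (Matrix.fromBlocks S₁₁ S₁₂ S₁₂ᵀ S₂₂ *ᵥ x))) * exp (-(∑ X ∈ 𝒳, E X x))) := by
  -- the forced split `Σ_X E_X = V₁ + V₂ ∘ far`
  have hsplit := sum_localTerms_split 𝒳 E hloc
  have hV₁ : ∀ x : n₁ ⊕ n₂ → ℝ, F₁ (fun i => x (Sum.inl i)) ≠ 0 → F₂ (fun i => x (Sum.inr i)) ≠ 0 →
      |(fun y : n₁ ⊕ n₂ → ℝ => ∑ X ∈ 𝒳.filter (fun X => ∃ i : n₁, Sum.inl i ∈ X), E X y) x| ≤ Fintype.card n₁ * C₀ :=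
    fun x h1 h2 => (abs_nearSum_le 𝒳 E w x fun X hX ht => hw X hX ht x h1 h2).trans (nearNorm_le_card_mul 𝒳 w hw0 hnorm)
  have e1 : ∀ x : n₁ ⊕ n₂ → ℝ,
      exp (-(∑ X ∈ 𝒳, E X x)) =
        exp (-((fun y : n₁ ⊕ n₂ → ℝ => ∑ X ∈ 𝒳.filter (fun X => ∃ i : n₁, Sum.inl i ∈ X), E X y) x +
          (fun x₂ : n₂ → ℝ => ∑ X ∈ 𝒳.filter (fun X => ¬ ∃ i : n₁, Sum.inl i ∈ X), E X (Sum.elim 0 x₂))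
            (fun i => x (Sum.inr i)))) := fun x => by
    rw [hsplit x]
  have hB'' : Integrable fun x : n₁ ⊕ n₂ → ℝ => (F₁ (fun i => x (Sum.inl i)) * F₂ (fun i => x (Sum.inr i))) *
      (exp (-(x ⬝ᵥ (Matrix.fromBlocks S₁₁ S₁₂ S₁₂ᵀ S₂₂ *ᵥ x))) *
        exp (-((fun y : n₁ ⊕ n₂ → ℝ => ∑ X ∈ 𝒳.filter (fun X => ∃ i : n₁, Sum.inl i ∈ X), E X y) x +
          (fun x₂ : n₂ → ℝ => ∑ X ∈ 𝒳.filter (fun X => ¬ ∃ i : n₁, Sum.inl i ∈ X), E X (Sum.elim 0 x₂))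
            (fun i => x (Sum.inr i))))) :=
    hB'.congr (Filter.Eventually.of_forall fun x => by beta_reduce; rw [e1 x])
  have key := perturbedMoment_le_of_shifted_fibres S₁₁ Q₁ S₁₂ S₂₂ F₁ F₂
    (fun y : n₁ ⊕ n₂ → ℝ => ∑ X ∈ 𝒳.filter (fun X => ∃ i : n₁, Sum.inl i ∈ X), E X y)
    (fun x₂ : n₂ → ℝ => ∑ X ∈ 𝒳.filter (fun X => ¬ ∃ i : n₁, Sum.inl i ∈ X), E X (Sum.elim 0 x₂))
    hF₁ hF₂ hC hV₁ hA hB hB'' hfib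
  have eN : (fun x : n₁ ⊕ n₂ → ℝ => (F₁ (fun i => x (Sum.inl i)) * F₂ (fun i => x (Sum.inr i))) *
        ((exp (x ⬝ᵥ (Matrix.fromBlocks Q₁ 0 0 (0 : Matrix n₂ n₂ ℝ) *ᵥ x)) *
          exp (-(x ⬝ᵥ (Matrix.fromBlocks S₁₁ S₁₂ S₁₂ᵀ S₂₂ *ᵥ x)))) * exp (-(∑ X ∈ 𝒳, E X x)))) =
      fun x => (F₁ (fun i => x (Sum.inl i)) * F₂ (fun i => x (Sum.inr i))) *
        ((exp (x ⬝ᵥ (Matrix.fromBlocks Q₁ 0 0 (0 : Matrix n₂ n₂ ℝ) *ᵥ x)) *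
          exp (-(x ⬝ᵥ (Matrix.fromBlocks S₁₁ S₁₂ S₁₂ᵀ S₂₂ *ᵥ x)))) *
        exp (-((fun y : n₁ ⊕ n₂ → ℝ => ∑ X ∈ 𝒳.filter (fun X => ∃ i : n₁, Sum.inl i ∈ X), E X y) x +
          (fun x₂ : n₂ → ℝ => ∑ X ∈ 𝒳.filter (fun X => ¬ ∃ i : n₁, Sum.inl i ∈ X), E X (Sum.elim 0 x₂))
            (fun i => x (Sum.inr i))))) := funext fun x => by rw [e1 x]
  have eD : (fun x : n₁ ⊕ n₂ → ℝ => (F₁ (fun i => x (Sum.inl i)) * F₂ (fun i => x (Sum.inr i))) *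
        (exp (-(x ⬝ᵥ (Matrix.fromBlocks S₁₁ S₁₂ S₁₂ᵀ S₂₂ *ᵥ x))) * exp (-(∑ X ∈ 𝒳, E X x)))) =
      fun x => (F₁ (fun i => x (Sum.inl i)) * F₂ (fun i => x (Sum.inr i))) *
        (exp (-(x ⬝ᵥ (Matrix.fromBlocks S₁₁ S₁₂ S₁₂ᵀ S₂₂ *ᵥ x))) *
        exp (-((fun y : n₁ ⊕ n₂ → ℝ => ∑ X ∈ 𝒳.filter (fun X => ∃ i : n₁, Sum.inl i ∈ X), E X y) x +
          (fun x₂ : n₂ → ℝ => ∑ X ∈ 𝒳.filter (fun X => ¬ ∃ i : n₁, Sum.inl i ∈ X), E X (Sum.elim 0 x₂))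
            (fun i => x (Sum.inr i))))) := funext fun x => by rw [e1 x]
  rw [eN, eD]
  exact key

end LocalTerms

end Summit.QuantumFields.BalabanUV.T4Continuum.NE7b.LocalPerturbationSandwich
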